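import Mathlib.LinearAlgebra.Matrix.Rank
import Literature.LinearAlgebra.Matrix.RowOperationCertificate
import HarnessLib

/-!
# Integer row-operation certificates for `rank ≥ n`, checked by `decide`

Topic `Literature/LinearAlgebra/Matrix`; a trunk-independent tool, the integer companion of
`RowOperationCertificate.lean`.  To certify `rank M ≥ n` for an explicit matrix `M` over a field of
characteristic zero whose entries are integers, one exhibits `n` sparse INTEGER row combinations
`R_a = ∑_{(r,λ) ∈ rows[a]} λ · M_r` (`a < n`) and pivot columns `piv[a]` with `R_a(piv[a]) ≠ 0` and
`R_a(piv[b]) = 0` for `b < a` (lower-triangular with non-zero diagonal on the pivots).  The check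
`intTriCheck` is a closed Boolean computation over `ℤ` on row/column CODES `r, c : ℕ` (the matrix is
presented as `A : ℕ → ℕ → ℤ` together with decoders `fr : ℕ → m`, `fc : ℕ → κ`), so that
`decide` / `decide +kernel` evaluates it without touching the field; `le_rank_of_intTriCheck`
transports a successful check to `n ≤ rank (M : Matrix m κ F)` for every field `F` of characteristic
zero via `card_le_rank_of_keyTriangular_mul`.  Certificates are found outside Lean by exact
fraction-free elimination; only their verification is in the kernel.  Everything here is PROVED.

First client: the tangency-flattening rank `rank Tang(⟨2,2,2⟩) = 64 > 60` of Doležálek–Michałek 2026,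
§5.1 (`Computability/AlgebraicComplexity/TangencyFlatteningMatMulTwo.lean`).
-/

namespace Literature.LinearAlgebra.Matrix

open _root_.Matrix

/-! ## The Boolean certificate check -/

/-- Entry `(a, b)` of `P · A` restricted to the pivot columns: `∑_{(r,λ) ∈ rows[a]} λ · A r (piv[b])`,
computed over `ℤ` on codes (`rows[a] = []`, `piv[b] = 0` out of range). [folklore] -/
def intCertVal (A : ℕ → ℕ → ℤ) (rows : List (List (ℕ × ℤ))) (piv : List ℕ) (a b : ℕ) : ℤ :=
  ((rows.getD a []).map fun rc => rc.2 * A rc.1 (piv.getD b 0)).sum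

/-- The certificate test: for all `a, b < n`, `intCertVal a b = 0` if `b < a` and `intCertVal a a ≠ 0`
(the `n × n` matrix `(P A)_{a, piv b}` is lower-triangular with non-zero diagonal). [folklore] -/
def intTriCheck (n : ℕ) (A : ℕ → ℕ → ℤ) (rows : List (List (ℕ × ℤ))) (piv : List ℕ) : Bool :=
  (List.range n).all fun a => (List.range n).all fun b =>
    (if b < a then intCertVal A rows piv a b == 0 else true) &&
      (if b = a then intCertVal A rows piv a b != 0 else true)

/-- What a successful check says. [folklore] -/
theorem intTriCheck_spec {n : ℕ} {A : ℕ → ℕ → ℤ} {rows : List (List (ℕ × ℤ))} {piv : List ℕ}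
    (h : intTriCheck n A rows piv = true) {a b : ℕ} (ha : a < n) (hb : b < n) :
    (b < a → intCertVal A rows piv a b = 0) ∧ (b = a → intCertVal A rows piv a b ≠ 0) := by
  unfold intTriCheck at h
  rw [List.all_eq_true] at h
  have h' := h a (List.mem_range.2 ha)
  rw [List.all_eq_true] at h'
  have h'' := h' b (List.mem_range.2 hb)
  rw [Bool.and_eq_true] at h''
  refine ⟨fun hlt => ?_, fun heq => ?_⟩
  · have := h''.1
    rw [if_pos hlt] at this
    simpa using this
  · have := h''.2
    rw [if_pos heq] at this
    simpa [bne_iff_ne] using this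

/-! ## Soundness: a checked certificate bounds the rank over any field of characteristic zero -/

section Sound

variable {F : Type*} [Field F] {m κ : Type*}

/-- The row vector `∑_{(r,λ) ∈ L} λ · e_{fr r} ∈ F^m` of a sparse integer row combination. [folklore] -/
def intCertRow [DecidableEq m] (fr : ℕ → m) : List (ℕ × ℤ) → m → F
  | [] => 0
  | rc :: L => Pi.single (fr rc.1) (rc.2 : F) + intCertRow fr L

/-- Pairing a sparse row combination with an integer column gives the integer `intCertVal`-type sum.
[folklore] -/
theorem sum_intCertRow_mul [Fintype m] [DecidableEq m] (fr : ℕ → m) (g : m → ℤ) (L : List (ℕ × ℤ)) :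
    ∑ i, intCertRow (F := F) fr L i * (g i : F) = ((L.map fun rc => rc.2 * g (fr rc.1)).sum : ℤ) := by
  induction L with
  | nil => simp [intCertRow]
  | cons rc L ih =>
    simp only [intCertRow, Pi.add_apply, add_mul, Finset.sum_add_distrib, ih, List.map_cons,
      List.sum_cons, Int.cast_add, Int.cast_mul]
    congr 1
    simp only [Pi.single_apply, ite_mul, zero_mul, Finset.sum_ite_eq', Finset.mem_univ, if_true]

/-- **Soundness of integer row certificates.** If `intTriCheck n A rows piv` succeeds for the integer
presentation `A r c = M (fr r) (fc c)` of an integer matrix `M`, then `n ≤ rank M` over every field of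
characteristic zero. [folklore] -/
theorem le_rank_of_intTriCheck [CharZero F] [Fintype m] [Fintype κ] [DecidableEq m]
    (M : Matrix m κ ℤ) (fr : ℕ → m) (fc : ℕ → κ) {n : ℕ} {rows : List (List (ℕ × ℤ))}
    {piv : List ℕ} (h : intTriCheck n (fun r c => M (fr r) (fc c)) rows piv = true) :
    n ≤ (M.map (Int.cast : ℤ → F)).rank := by
  classical
  set P : Matrix (Fin n) m F := fun a => intCertRow fr (rows.getD a []) with hP
  have hPA : ∀ (a : Fin n) (b : ℕ), (P * M.map (Int.cast : ℤ → F)) a (fc (piv.getD b 0)) =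
      (intCertVal (fun r c => M (fr r) (fc c)) rows piv a b : F) := by
    intro a b
    rw [Matrix.mul_apply]
    simp only [hP, Matrix.map_apply]
    rw [sum_intCertRow_mul fr (fun i => M i (fc (piv.getD b 0))) (rows.getD a [])]
    rfl
  have key := card_le_rank_of_keyTriangular_mul (M.map (Int.cast : ℤ → F)) P
    (fun a : Fin n => fc (piv.getD a 0)) (fun a : Fin n => (a : ℕ)) Fin.val_injective
    (fun a => by
      rw [hPA a a]
      exact Int.cast_ne_zero.2 ((intTriCheck_spec h a.2 a.2).2 rfl))
    (fun a b hba => by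
      rw [hPA a b, (intTriCheck_spec h a.2 b.2).1 hba, Int.cast_zero])
  simpa using key

end Sound

end Literature.LinearAlgebra.Matrix
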